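import Literature.NumberTheory.EllipticCurves.H1UnramifiedFinite
import Literature.NumberTheory.EllipticCurves.SelmerProofs
import Literature.NumberTheory.GaloisRepresentations.IntegralGaloisActionProofs
import Literature.NumberTheory.GaloisRepresentations.ContinuousH1
import HarnessLib

/-!
# Selmer classes are unramified outside `S` (Silverman AEC Cor. X.4.4): decomposition and glue

D-0014 decomposition file for the named fact `WeierstrassCurve.selmerGroup_le_h1Unramified`
(`Literature.NumberTheory.EllipticCurves.SelmerUnramified`; Silverman, *AEC*, Cor. X.4.4: for an
elliptic curve `E/K` over a number field, `n ≠ 0` and `S ⊇ {bad places} ∪ {v : v(n) > 0}`, one has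
`Sel^(n)(E/K) ⊆ H¹(G_{K̄/K}, E[n]; S)`), which together with Lemma X.4.3 gives the finiteness of the
Selmer group (X.4.2(b), assembled in `SelmerUnramified`) and hence of `Ш(E/K)[n]`.

Silverman's proof (2nd ed., X.§4, inside the proof of Thm. 4.2(b); held PDF p. 286): a Selmer
class `ξ` is trivial in `WC(E/K_v)`, so `ξ_σ = P^σ - P` on the decomposition group `G_v` for some
`P ∈ E(K̄_v)`; for `σ` in the inertia group `I_v ⊂ G_v` one reduces modulo `v`:
`\widetilde{P^σ - P} = Õ` since inertia acts trivially on `Ẽ_v`, and `P^σ - P ∈ E[n]` injects into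
`Ẽ_v` (VIII.1.4 = VII.3.1(b), `v ∤ n`, good reduction), so `P^σ = P` and `ξ_σ = 0`. In the tree
the local condition is phrased
with the completion (`Γ_{K_v} = Gal(K̄_v/K_v)` acting on `E(K̄_v)`, restriction `Γ_{K_v} → Γ_K`
along a `K`-embedding `ι : K̄ → K̄_v`, files `Sha`/`Selmer`), whereas `H¹(G_K, M; S)` is phrased
with the inertia groups `I_𝔓 ≤ Γ_K` of *all* primes `𝔓` of `\bar ℤ_K` above `v ∉ S`
(`SelmerUnramified`). Accordingly the proof splits into:

* **(LG) local–global compatibility of inertia** — Silverman's tacit identification (X.§4,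
  opening, before Remark 4.1.1) of the decomposition group `G_v ⊂ G_{K̄/K}` with a group acting
  on `E(K̄_v)`: every element of `I_𝔓`, for the prime `𝔓 = 𝔓_{ι,𝔐}` cut out by `ι` and a prime
  `𝔐` of the local absolute integers, is the restriction of an element of the local inertia group
  `I_𝔐 ≤ Γ_{K_v}`.
  This is Neukirch, *ANT*, II (9.6) (`G_w(L|K) ≅ G(L_w|K_v)`, `I_w(L|K) ≅ I(L_w|K_v)`), vendored
  as the named fact `IsDedekindDomain.HeightOneSpectrum.exists_mem_inertia_apply_eq`.
* **(RED) the reduction step** displayed above, vendored as the named fact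
  `WeierstrassCurve.smul_localPoints_eq_of_mem_inertia` (it needs the reduction map on `E(K̄_v)`
  and Chapters IV/VII of AEC, absent from the tree and from Mathlib).
* **everything else, proved here**: the cocycle bookkeeping (`ξ` trivial in `H¹(K_v, E)` gives
  `P` with `ι_* ξ_{res σ} = σP - P`; `n(σP - P) = O`; `ξ` vanishes on `I_𝔓`), via the explicit
  `H¹` of `GaloisRepresentations/ContinuousH1` and the cocycle criteria of `H1UnramifiedFinite`;
  the passage from the prime cut out by the chosen embedding to *all* primes above `v`
  (transitivity of `Γ_K`, `IntegralGaloisActionProofs.exists_smul_eq_of_mem_primesAbove_holds`;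
  change of embedding `𝔓_{ι ∘ τ, 𝔐} = τ⁻¹ • 𝔓_{ι,𝔐}`; independence of the local kernel from the
  embedding, `SelmerProofs.selmerLocalKer_eq_of_algHom_holds` — Silverman's Remark X.4.1.1 /
  VIII.§2 (Definition before Prop. 2.1) that unramifiedness does not depend on the extension of
  `v` to `K̄`).

## Main declarations

* `IsDedekindDomain.HeightOneSpectrum.localAbsIntegers v` (`\bar 𝓞_v`, the integral closure of
  `𝓞_v = v.adicCompletionIntegers K` in `K̄_v`), `localPrimesAbove v` (its primes above `𝓂_v`;
  nonempty, `localPrimesAbove_nonempty`), `absIntegersToLocal v ι : \bar ℤ_K →+* \bar 𝓞_v` and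
  `primeBelow v ι 𝔐 = 𝔓_{ι,𝔐}` (a prime above `v`, `primeBelow_mem_primesAbove`; behaviour under
  `ι ↦ ι ∘ τ`, `primeBelow_comp`).
* `IsDedekindDomain.HeightOneSpectrum.exists_mem_inertia_apply_eq v` (**named fact**, (LG)).
* `WeierstrassCurve.smul_localPoints_eq_of_mem_inertia W` (**named fact**, (RED)).
* `WeierstrassCurve.selmerLocalKerOfEmb_le_unramifiedKer_primeBelow` (**proved**): the local Selmer
  condition along `ι` implies unramified at `𝔓_{ι,𝔐}`, granted (LG) at `v` and (RED).
* `WeierstrassCurve.selmerLocalKer_le_unramifiedKer` (**proved**): the same at every `𝔓 ∣ v`.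
* `WeierstrassCurve.selmerGroup_le_h1Unramified_of_facts` (**proved**):
  `(∀ v, (LG) at v) → (RED) → W.selmerGroup_le_h1Unramified`.

Remaining DAG below `WeierstrassCurve.finite_selmerGroup` after this file: (LG), (RED), and
Prop. VIII.1.6 (`Literature.NumberTheory.EllipticCurves.finite_unramifiedHoms`, file `H1UnramifiedFinite`).

## References

* [SilvermanAEC2009] J. H. Silverman, *The Arithmetic of Elliptic Curves*, 2nd ed., GTM 106,
  Springer 2009, doi:10.1007/978-0-387-09494-6: X.§4, pp. 331 ff. (decomposition groups `G_v`,
  Remark 4.1.1, Thm. 4.2 and its proof, Lemma 4.3, Cor. 4.4; held PDF pp. 284–287); VIII.§1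
  Prop. 1.4 (= VII.3.1(b)) and the proof of Prop. 1.5(b) (held PDF p. 187); VIII.§2, Definition
  before Prop. 2.1 (unramified classes; held PDF p. 191).
* [NeukirchANT1999] J. Neukirch, *Algebraic Number Theory*, Grundlehren 322, Springer 1999:
  Ch. II §8 (extensions of valuations, (8.1)), §9 Prop. (9.6) and (9.9), pp. 159–161 of the held
  copy (`G_w(L|K) ≅ G(L_w|K_v)`, `I_w(L|K) ≅ I(L_w|K_v)`; `1 → I_w → G_w → G(λ|κ) → 1`).

## Design

* Group-wide rules of `Sha`/`Selmer`/`SelmerUnramified`: `noncomputable section`,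
  `open scoped Classical`, one universe `u` with `K : Type u` (forced by
  `ContinuousCohomology.map`).
* No `IsNonarchimedeanLocalField`/`ValuativeRel` instance is available on `v.adicCompletion K`
  (cf. the design note of `GaloisRepresentations/GaloisRep`), so the local inertia group is not
  taken from `GaloisRepresentations/LocalGaloisGroup` (`Literature.NumberTheory.GaloisRepresentations.absInertia`) but spelled out as
  `𝔐.inertia Γ_{K_v}` (Mathlib's `Ideal.inertia`) for a prime `𝔐` of
  `Literature.absIntegers 𝓞_v K_v` above `𝓂_v`; there is exactly one such `𝔐` (`K_v` is henselian), a fact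
  neither proved nor used: all statements quantify over `𝔐`.
* (LG) is stated by the equation `ι (τ x) = σ (ι x)` rather than through `Literature.NumberTheory.EllipticCurves.resGalOfEmb`
  (equivalent, `Literature.NumberTheory.EllipticCurves.resGalOfEmb_eq_of_apply_eq`), so that it does not depend on file `Sha`.
* The local absolute integers and `primeBelow` are declared in Mathlib's
  `IsDedekindDomain.HeightOneSpectrum` namespace for the dot notation `v.localAbsIntegers`, like
  `v.primesAbove` (`IntegralGaloisAction`); the curve-level statements are deliberate dot-notation
  extensions in `namespace WeierstrassCurve`.
-/

noncomputable section

open scoped Classical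
open scoped Pointwise

open NumberField IsDedekindDomain

universe u

/-! ## Local absolute integers at a finite place; the prime of `\bar ℤ_K` cut out by an embedding -/

namespace IsDedekindDomain.HeightOneSpectrum

open Literature.NumberTheory.EllipticCurves Literature.NumberTheory.GaloisRepresentations Field

variable {K : Type u} [Field K] [NumberField K] (v : HeightOneSpectrum (𝓞 K))

/-- The ring `\bar 𝓞_v ⊆ K̄_v` of **local absolute integers** at the finite place `v`: the integral
closure of the complete discrete valuation ring `𝓞_v = v.adicCompletionIntegers K` in the
algebraic closure `K̄_v = AlgebraicClosure (v.adicCompletion K)` of the completion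
(`Literature.NumberTheory.GaloisRepresentations.absIntegers`, with its action of `Γ_{K_v} = Gal(K̄_v/K_v)`). It is the valuation ring of
the unique extension of `v` to `K̄_v` (Neukirch, *Algebraic Number Theory*, Ch. II (6.2) and §8),
a fact not used here.
Neukirch, *ANT*, Ch. II §8–§9; Silverman, *AEC*, VII.§1 and X.§4. [folklore] -/
abbrev localAbsIntegers :
    Subalgebra (v.adicCompletionIntegers K) (AlgebraicClosure (v.adicCompletion K)) :=
  absIntegers (v.adicCompletionIntegers K) (v.adicCompletion K)

/-- The primes of `\bar 𝓞_v` above the maximal ideal `𝓂_v` of `𝓞_v` (Mathlib's `Ideal.primesOver`);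
there is exactly one (henselian `K_v`), a fact not used here: statements quantify over it.
Neukirch, *ANT*, Ch. II (6.2), (8.1); Silverman, *AEC*, X.§4. [folklore] -/
def localPrimesAbove : Set (Ideal (localAbsIntegers v)) :=
  (IsLocalRing.maximalIdeal (v.adicCompletionIntegers K)).primesOver (localAbsIntegers v)

variable {v} in
/-- Membership in `v.localPrimesAbove`: prime and lying over `𝓂_v`. [folklore] -/
theorem mem_localPrimesAbove_iff {𝔐 : Ideal (localAbsIntegers v)} :
    𝔐 ∈ v.localPrimesAbove ↔
      𝔐.IsPrime ∧ 𝔐.LiesOver (IsLocalRing.maximalIdeal (v.adicCompletionIntegers K)) :=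
  Iff.rfl

/-- `\bar 𝓞_v` has a prime above `𝓂_v` (lying over for the integral extension `\bar 𝓞_v / 𝓞_v`).
Neukirch, *ANT*, Ch. II (8.1). [folklore] -/
theorem localPrimesAbove_nonempty : (v.localPrimesAbove).Nonempty := by
  have hinj : Function.Injective
      (algebraMap (v.adicCompletionIntegers K) (AlgebraicClosure (v.adicCompletion K))) := by
    rw [IsScalarTower.algebraMap_eq (v.adicCompletionIntegers K) (v.adicCompletion K)
      (AlgebraicClosure (v.adicCompletion K))]
    exact (algebraMap (v.adicCompletion K) _).injective.comp Subtype.val_injective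
  haveI : FaithfulSMul (v.adicCompletionIntegers K) (localAbsIntegers v) :=
    (faithfulSMul_iff_algebraMap_injective _ _).mpr fun x y h => hinj (congrArg Subtype.val h)
  obtain ⟨𝔐, h𝔐, h⟩ :=
    Ideal.exists_maximal_ideal_liesOver_of_isIntegral (S := localAbsIntegers v)
      (IsLocalRing.maximalIdeal (v.adicCompletionIntegers K))
  exact ⟨𝔐, h𝔐.isPrime, h⟩

variable (ι : AlgebraicClosure K →ₐ[K] AlgebraicClosure (v.adicCompletion K))

/-- A `K`-embedding `ι : K̄ → K̄_v` maps algebraic integers to local absolute integers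
(integral over `𝓞 K ⊆ 𝓞_v`). Neukirch, *ANT*, Ch. II §8. [folklore] -/
theorem isIntegral_apply_of_mem_absIntegers {b : AlgebraicClosure K}
    (hb : b ∈ absIntegers (𝓞 K) K) : IsIntegral (v.adicCompletionIntegers K) (ι b) := by
  have h1 : IsIntegral (𝓞 K) (ι b) := (mem_integralClosure_iff (𝓞 K) _).mp hb |>.map ι
  obtain ⟨p, hp, hpb⟩ := h1
  refine ⟨p.map (algebraMap (𝓞 K) (v.adicCompletionIntegers K)), hp.map _, ?_⟩
  rw [Polynomial.eval₂_map]
  convert hpb using 2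
  ext x
  change algebraMap (v.adicCompletion K) (AlgebraicClosure (v.adicCompletion K))
      ((algebraMap (𝓞 K) (v.adicCompletionIntegers K) x : v.adicCompletion K)) = _
  rw [IsScalarTower.algebraMap_apply (𝓞 K) K (AlgebraicClosure (v.adicCompletion K)),
    IsScalarTower.algebraMap_apply K (v.adicCompletion K) (AlgebraicClosure (v.adicCompletion K))]
  rfl

/-- The ring homomorphism `\bar ℤ_K → \bar 𝓞_v` induced by a `K`-embedding `ι : K̄ → K̄_v`.
Neukirch, *ANT*, Ch. II §8 (the embedding `L ↪ L_w`). [folklore] -/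
def absIntegersToLocal : absIntegers (𝓞 K) K →+* localAbsIntegers v where
  toFun b := ⟨ι b, (mem_integralClosure_iff _ _).mpr (isIntegral_apply_of_mem_absIntegers v ι b.2)⟩
  map_one' := Subtype.ext (map_one ι)
  map_mul' x y := Subtype.ext (map_mul ι x.1 y.1)
  map_zero' := Subtype.ext (map_zero ι)
  map_add' x y := Subtype.ext (map_add ι x.1 y.1)

/-- Unfolding `absIntegersToLocal`. [folklore] -/
@[simp]
theorem coe_absIntegersToLocal_apply (b : absIntegers (𝓞 K) K) :
    (absIntegersToLocal v ι b : AlgebraicClosure (v.adicCompletion K)) = ι b :=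
  rfl

/-- The prime `𝔓_{ι,𝔐} = ι⁻¹(𝔐) ∩ \bar ℤ_K` of `\bar ℤ_K` **cut out by** the embedding
`ι : K̄ → K̄_v` and a prime `𝔐` of `\bar 𝓞_v`: Silverman's "extension of `v` to `K̄`" attached to
the embedding `K̄ ⊂ K̄_v` (AEC X.§4, before Remark 4.1.1), Neukirch's `w = \bar v ∘ τ`
(ANT II (8.1)). [folklore] -/
def primeBelow (𝔐 : Ideal (localAbsIntegers v)) : Ideal (absIntegers (𝓞 K) K) :=
  𝔐.comap (absIntegersToLocal v ι)

variable {v ι}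

/-- Membership in `primeBelow`: `b ∈ 𝔓_{ι,𝔐} ↔ ι b ∈ 𝔐`. [folklore] -/
theorem mem_primeBelow_iff {𝔐 : Ideal (localAbsIntegers v)} {b : absIntegers (𝓞 K) K} :
    b ∈ v.primeBelow ι 𝔐 ↔ absIntegersToLocal v ι b ∈ 𝔐 :=
  Ideal.mem_comap

/-- The maximal ideal of `𝓞_v` is cut out by `Valued.v < 1` (`𝓞_v` is the valuation subring of the
`v`-adic valuation on `K_v`). [folklore] -/
theorem mem_maximalIdeal_adicCompletionIntegers_iff {a : v.adicCompletionIntegers K} :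
    a ∈ IsLocalRing.maximalIdeal (v.adicCompletionIntegers K) ↔
      Valued.v (a : v.adicCompletion K) < 1 :=
  Valuation.mem_maximalIdeal_iff _ _

/-- A global integer lies in `𝓂_v ⊆ 𝓞_v` iff it lies in `v`. [folklore] -/
theorem algebraMap_mem_maximalIdeal_adicCompletionIntegers_iff (x : 𝓞 K) :
    algebraMap (𝓞 K) (v.adicCompletionIntegers K) x ∈
        IsLocalRing.maximalIdeal (v.adicCompletionIntegers K) ↔ x ∈ v.asIdeal := by
  rw [mem_maximalIdeal_adicCompletionIntegers_iff, algebraMap_adicCompletionIntegers_apply,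
    valuedAdicCompletion_eq_valuation', valuation_lt_one_iff_mem]

/-- `absIntegersToLocal` is compatible with the structure maps from `𝓞 K`. [folklore] -/
theorem absIntegersToLocal_algebraMap (x : 𝓞 K) :
    absIntegersToLocal v ι (algebraMap (𝓞 K) (absIntegers (𝓞 K) K) x) =
      algebraMap (v.adicCompletionIntegers K) (localAbsIntegers v)
        (algebraMap (𝓞 K) (v.adicCompletionIntegers K) x) := by
  apply Subtype.ext
  rw [coe_absIntegersToLocal_apply]
  change ι (algebraMap (𝓞 K) (AlgebraicClosure K) x) =
    algebraMap (v.adicCompletionIntegers K) (AlgebraicClosure (v.adicCompletion K))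
      (algebraMap (𝓞 K) (v.adicCompletionIntegers K) x)
  rw [IsScalarTower.algebraMap_apply (𝓞 K) K (AlgebraicClosure K), ι.commutes,
    IsScalarTower.algebraMap_apply K (v.adicCompletion K) (AlgebraicClosure (v.adicCompletion K)),
    IsScalarTower.algebraMap_apply (v.adicCompletionIntegers K) (v.adicCompletion K)
      (AlgebraicClosure (v.adicCompletion K))]
  congr 1

/-- `𝔓_{ι,𝔐}` lies above `v` when `𝔐` lies above `𝓂_v`. Neukirch, *ANT*, Ch. II (8.1). [folklore] -/
theorem primeBelow_mem_primesAbove {𝔐 : Ideal (localAbsIntegers v)} (h𝔐 : 𝔐 ∈ v.localPrimesAbove) :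
    v.primeBelow ι 𝔐 ∈ v.primesAbove := by
  haveI := h𝔐.1
  refine ⟨Ideal.comap_isPrime _ _, ⟨?_⟩⟩
  ext x
  rw [Ideal.under_def, Ideal.mem_comap, mem_primeBelow_iff, absIntegersToLocal_algebraMap,
    ← Ideal.mem_comap, ← Ideal.under_def, ← h𝔐.2.over,
    algebraMap_mem_maximalIdeal_adicCompletionIntegers_iff]

/-- Changing the embedding by `τ ∈ Γ_K` moves the prime cut out by it:
`𝔓_{ι ∘ τ, 𝔐} = τ⁻¹ • 𝔓_{ι,𝔐}`. Neukirch, *ANT*, Ch. II (8.1) (`w = \bar v ∘ τ`) and (9.1).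
[folklore] -/
theorem primeBelow_comp (τ : AlgebraicClosure K ≃ₐ[K] AlgebraicClosure K)
    (𝔐 : Ideal (localAbsIntegers v)) :
    v.primeBelow (ι.comp (τ : AlgebraicClosure K →ₐ[K] AlgebraicClosure K)) 𝔐 =
      (show absoluteGaloisGroup K from τ)⁻¹ • v.primeBelow ι 𝔐 := by
  ext b
  rw [mem_primeBelow_iff, Ideal.mem_inv_pointwise_smul_iff, mem_primeBelow_iff]
  exact Iff.of_eq (congrArg (· ∈ 𝔐) (Subtype.ext rfl))

/-- **Local inertia surjects onto global inertia** (the local–global compatibility of inertia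
groups). Let `v` be a finite place of the number field `K`, `ι : K̄ → K̄_v` a `K`-embedding into an
algebraic closure of the completion `K_v`, `𝔐` a prime of the local absolute integers `\bar 𝓞_v`
above `𝓂_v`, and `𝔓 = 𝔓_{ι,𝔐}` the prime of `\bar ℤ_K` it cuts out (`primeBelow`). Then every
element `τ` of the (absolute) inertia group `I_𝔓 ≤ Γ_K = Gal(K̄/K)` is the restriction along `ι` of
an element `σ` of the local inertia group `I_𝔐 ≤ Γ_{K_v} = Gal(K̄_v/K_v)`: `ι (τ x) = σ (ι x)` for
all `x ∈ K̄`.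
Source: Neukirch, *Algebraic Number Theory*, Ch. II §9, Prop. (9.6): for a Galois extension `L|K`
and `w | v`, restriction `G(L_w|K_v) → G_w(L|K)` is an isomorphism carrying `I(L_w|K_v)` onto
`I_w(L|K)` (for infinite `L|K`, `L_w` is the localization `L K_v`, loc. cit.); here `L = K̄`, `w`
the valuation of `𝔓_{ι,𝔐}`, and one composes with the restriction `Gal(K̄_v/K_v) → G(L_w|K_v)`,
which is onto (`K̄_v/K_v` is normal) and onto on inertia groups by the exact sequences (9.9)
`1 → I → G → G(λ|κ) → 1` for `K̄_v|K_v` and `L_w|K_v` (both residue fields are `\bar κ`).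
Named fact (D-0014); it serves Silverman's identification of the decomposition group
`G_v ⊂ G_{K̄/K}` with a group acting on `E(K̄_v)` (AEC X.§4, before Remark 4.1.1) in Cor. X.4.4.
[cite: NeukirchANT1999, Ch. II §9 Prop. (9.6), with (9.9)] -/
def exists_mem_inertia_apply_eq (v : HeightOneSpectrum (𝓞 K)) : Prop :=
  ∀ (ι : AlgebraicClosure K →ₐ[K] AlgebraicClosure (v.adicCompletion K))
    {𝔐 : Ideal (localAbsIntegers v)} (_ : 𝔐 ∈ v.localPrimesAbove) {τ : absoluteGaloisGroup K}
    (_ : τ ∈ (v.primeBelow ι 𝔐).inertia (absoluteGaloisGroup K)),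
    ∃ σ ∈ 𝔐.inertia (absoluteGaloisGroup (v.adicCompletion K)),
      ∀ x : AlgebraicClosure K, ι (τ • x) = σ • ι x

end IsDedekindDomain.HeightOneSpectrum

/-! ## The reduction step and Cor. X.4.4 -/

namespace Literature.NumberTheory.EllipticCurves

variable {K : Type u} [Field K] {E : Type u} [Field E] [Algebra K E]

/-- An element `σ ∈ Γ_E` restricts along `ι : K̄ → K̄_E` to `τ ∈ Γ_K` as soon as `ι (τ x) = σ (ι x)`
for all `x` (the defining property `ι ∘ res σ = σ ∘ ι` of `resGalOfEmb`, and injectivity of `ι`).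
Serre, *Galois Cohomology*, II.§1.1. [folklore] -/
theorem resGalOfEmb_eq_of_apply_eq (ι : AlgebraicClosure K →ₐ[K] AlgebraicClosure E)
    {σ : Field.absoluteGaloisGroup E} {τ : Field.absoluteGaloisGroup K}
    (h : ∀ x : AlgebraicClosure K, ι (τ • x) = σ • ι x) : resGalOfEmb ι σ = τ := by
  refine AlgEquiv.ext fun x ↦ ι.injective ?_
  exact (apply_resGalAuxOfEmb_apply ι σ x).trans (h x).symm


end Literature.NumberTheory.EllipticCurves

namespace WeierstrassCurve

open Literature.NumberTheory.EllipticCurves Literature.NumberTheory.GaloisRepresentations Field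

variable {K : Type u} [Field K] [NumberField K] (W : WeierstrassCurve K)

/-- **The reduction step of Silverman's proof of AEC Thm. X.4.2(b)** (X.§4), stated for the
tree's local objects. Let `E/K` be an elliptic curve over a number field, `v` a finite place of
good reduction (`v ∉ W.badPlaces (𝓞 K)`, file `LocalReduction`) not dividing `n`
(`(n : 𝓞 K) ∉ v`), `𝔐` the prime of the local absolute integers `\bar 𝓞_v ⊆ K̄_v` above `𝓂_v`
and `I_v = I_𝔐 ≤ Γ_{K_v}` its inertia group (Silverman's inertia group `I_v ⊂ G_v`, the
decomposition group `G_v ⊂ G_{K̄/K}` being identified with a group acting on `E(K̄_v)`, X.§4,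
before Remark 4.1.1). If `σ ∈ I_v` and `P ∈ E(K̄_v)` satisfy `P^σ - P ∈ E[n]`, i.e.
`n (P^σ - P) = O`, then `P^σ = P`. (Printed proof: reduce modulo `v` — inertia acts trivially on
`Ẽ_v`, so `\widetilde{P^σ - P} = P̃^σ - P̃ = Õ`; and `E[n]` injects into `Ẽ_v` for `v ∤ n` of good
reduction, Prop. VIII.1.4 = VII.3.1(b), whose proof uses the reduction homomorphism VII.2.1 and
the formal group, IV.3.2(b).) The same step proves Prop. VIII.1.5(b) (with `Q ∈ E(K̄)`,
`[m]Q ∈ E(K)`). Named fact (D-0014): the reduction map on `E(K̄_v)` and Chapters IV/VII are not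
in the tree.
[cite: SilvermanAEC2009, X.§4, proof of Thm. 4.2(b) (via Prop. VIII.1.4 = VII.3.1(b))] -/
def smul_localPoints_eq_of_mem_inertia : Prop :=
  ∀ [W.IsElliptic] (v : HeightOneSpectrum (𝓞 K)) (_hv : v ∉ W.badPlaces (𝓞 K)) {n : ℤ}
    (_hn : (n : 𝓞 K) ∉ v.asIdeal) {𝔐 : Ideal (v.localAbsIntegers)} (_h𝔐 : 𝔐 ∈ v.localPrimesAbove)
    {σ : absoluteGaloisGroup (v.adicCompletion K)}
    (_hσ : σ ∈ 𝔐.inertia (absoluteGaloisGroup (v.adicCompletion K)))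
    {P : localPoints W (v.adicCompletion K)}, n • (σ • P - P) = 0 → σ • P = P

variable {W}

/-- **Cor. X.4.4, local form at one embedding.** For an elliptic curve `E/K`, a finite place `v`
of good reduction with `v ∤ n`, a `K`-embedding `ι : K̄ → K̄_v` and a prime `𝔐` of `\bar 𝓞_v`
above `𝓂_v`: every class of `H¹(K, E[n])` dying in `H¹(K_v, E)` (the local Selmer condition along
`ι`) is unramified at the prime `𝔓_{ι,𝔐}` of `\bar ℤ_K` cut out by `ι`, granted the local–global
compatibility of inertia (`v.exists_mem_inertia_apply_eq`, Neukirch II (9.6)) and the reduction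
step (`W.smul_localPoints_eq_of_mem_inertia`). Proof as printed (Silverman, *AEC*, X.§4, proof of
Thm. 4.2(b)): a cocycle `ξ` of the class satisfies `ι_* ξ_{res σ} = P^σ - P` on `Γ_{K_v}` for some
`P ∈ E(K̄_v)`; for `τ ∈ I_𝔓` pick `σ ∈ I_𝔐` above it; `n (P^σ - P) = O`, so `P^σ = P` and
`ξ_τ = 0`: `ξ` vanishes identically on `I_𝔓`.
[cite: SilvermanAEC2009, Cor. X.4.4 (proof of Thm. X.4.2(b))] -/
theorem selmerLocalKerOfEmb_le_unramifiedKer_primeBelow {v : HeightOneSpectrum (𝓞 K)}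
    (hlg : v.exists_mem_inertia_apply_eq) (hred : W.smul_localPoints_eq_of_mem_inertia)
    [W.IsElliptic] (hv : v ∉ W.badPlaces (𝓞 K)) {n : ℤ} (hn : (n : 𝓞 K) ∉ v.asIdeal)
    (ι : AlgebraicClosure K →ₐ[K] AlgebraicClosure (v.adicCompletion K))
    {𝔐 : Ideal (v.localAbsIntegers)} (h𝔐 : 𝔐 ∈ v.localPrimesAbove) :
    selmerLocalKerOfEmb W (v.adicCompletion K) ι n ≤
      unramifiedKer (geomTorsion W n) (v.primeBelow ι 𝔐) := by
  intro c hc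
  obtain ⟨φ, rfl⟩ :=
    oneCocycleClass_surjective (discreteTopRep (absoluteGaloisGroup K) (geomTorsion W n)) c
  -- the local condition: `ι_* φ (res σ) = σ • P - P` on `Γ_{K_v}` for some `P ∈ E(K̄_v)`
  obtain ⟨P, hP⟩ := (oneCocycleClass_mem_resKer_iff _ _ _ φ).mp hc
  -- goal: `φ` is principal on `I_𝔓`; indeed it vanishes there
  refine (oneCocycleClass_mem_subgroupResKer_iff _ φ).mpr ⟨0, fun τ ↦ ?_⟩
  rw [smul_zero, sub_zero]
  obtain ⟨σ, hσI, hσ⟩ := hlg ι h𝔐 τ.2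
  have hT : pointsMapOfEmb W ι (φ.1 (τ : absoluteGaloisGroup K) : geomPoints W) = σ • P - P := by
    rw [← resGalOfEmb_eq_of_apply_eq ι hσ]
    exact hP σ
  -- `n • (σ • P - P) = 0`, hence `σ • P = P` by the reduction step
  have hn0 : n • ((φ.1 (τ : absoluteGaloisGroup K) : geomTorsion W n) : geomPoints W) = 0 :=
    (Submodule.mem_torsionBy_iff n _).mp (φ.1 (τ : absoluteGaloisGroup K)).2
  have hfix : σ • P = P := by
    refine hred v hv hn h𝔐 hσI ?_
    rw [← hT, ← map_zsmul, hn0, map_zero]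
  rw [hfix, sub_self] at hT
  exact Subtype.ext ((injective_iff_map_eq_zero _).mp (pointsMapOfEmb_injective W ι) _ hT)

/-- **Cor. X.4.4, local form.** For an elliptic curve `E/K` over a number field, a finite place
`v` of good reduction with `v ∤ n`, and *every* prime `𝔓` of `\bar ℤ_K` above `v`: the local Selmer
condition at `v` (vanishing in `H¹(K_v, E)`, tree convention: the chosen embedding
`closureEmb : K̄ → K̄_v`) forces a class of `H¹(K, E[n])` to be unramified at `𝔓`, granted the
two named facts. Reduction to `selmerLocalKerOfEmb_le_unramifiedKer_primeBelow`: `Γ_K` is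
transitive on the primes above `v` (`exists_smul_eq_of_mem_primesAbove_holds`), `𝔓 = g • 𝔓_{ι₀,𝔐}
= 𝔓_{ι₀ ∘ g⁻¹, 𝔐}` (`primeBelow_comp`), and the local kernel does not depend on the embedding
(`selmerLocalKer_eq_of_algHom_holds`, inner automorphisms act trivially on `H¹`) — which is
Silverman's remark that unramifiedness does not depend on the extension of `v` to `K̄`
(VIII.§2, Definition before Prop. 2.1; Remark X.4.1.1). [cite: SilvermanAEC2009, Cor. X.4.4] -/
theorem selmerLocalKer_le_unramifiedKer {v : HeightOneSpectrum (𝓞 K)}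
    (hlg : v.exists_mem_inertia_apply_eq) (hred : W.smul_localPoints_eq_of_mem_inertia)
    [W.IsElliptic] (hv : v ∉ W.badPlaces (𝓞 K)) {n : ℤ} (hn : (n : 𝓞 K) ∉ v.asIdeal)
    {𝔓 : Ideal (absIntegers (𝓞 K) K)} (h𝔓 : 𝔓 ∈ v.primesAbove) :
    selmerLocalKer W (v.adicCompletion K) n ≤ unramifiedKer (geomTorsion W n) 𝔓 := by
  obtain ⟨𝔐, h𝔐⟩ := v.localPrimesAbove_nonempty
  obtain ⟨g, hg⟩ := HeightOneSpectrum.exists_smul_eq_of_mem_primesAbove_holds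
    (HeightOneSpectrum.primeBelow_mem_primesAbove
      (ι := closureEmb (K := K) (v.adicCompletion K)) h𝔐) h𝔓
  have h1 : 𝔓 = v.primeBelow ((closureEmb (K := K) (v.adicCompletion K)).comp
      ((show AlgebraicClosure K ≃ₐ[K] AlgebraicClosure K from g⁻¹) :
        AlgebraicClosure K →ₐ[K] AlgebraicClosure K)) 𝔐 := by
    rw [HeightOneSpectrum.primeBelow_comp, ← hg]
    exact congrArg (· • _) (inv_inv g).symm
  rw [h1, ← selmerLocalKer_eq_of_algHom_holds W (v.adicCompletion K) _ n]
  exact selmerLocalKerOfEmb_le_unramifiedKer_primeBelow hlg hred hv hn _ h𝔐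

/-- **Silverman, AEC Cor. X.4.4, from its two printed ingredients.** For an elliptic curve `E/K`
over a number field, `n ≠ 0` and `S` a set of finite places containing the bad places and the
places dividing `n`, `Sel^(n)(E/K) ⊆ H¹(G_{K̄/K}, E[n]; S)` — the tree's named fact
`WeierstrassCurve.selmerGroup_le_h1Unramified` (`SelmerUnramified`) — granted, for every finite
place `v`, the local–global compatibility of inertia groups (`v.exists_mem_inertia_apply_eq`,
Neukirch II (9.6): Silverman's identification of `G_v ⊂ G_{K̄/K}` with a group acting on
`E(K̄_v)`) and the reduction step of the printed proof (`W.smul_localPoints_eq_of_mem_inertia`,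
via VIII.1.4). Everything else in the printed proof (cocycles, "`ξ` trivial in
`WC(E/K_v)` gives `P ∈ E(K̄_v)` with `ξ_σ = P^σ - P`", independence of the choices) is proved
here. [cite: SilvermanAEC2009, Cor. X.4.4 (proof of Thm. X.4.2(b))] -/
theorem selmerGroup_le_h1Unramified_of_facts
    (hlg : ∀ v : HeightOneSpectrum (𝓞 K), v.exists_mem_inertia_apply_eq)
    (hred : W.smul_localPoints_eq_of_mem_inertia) : W.selmerGroup_le_h1Unramified := by
  intro _ n _ S hbad hdiv c hc
  rw [mem_h1Unramified_iff]
  intro v hv 𝔓 h𝔓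
  have hv' : v ∉ W.badPlaces (𝓞 K) := fun h ↦ hv (hbad h)
  have hn' : (n : 𝓞 K) ∉ v.asIdeal := fun h ↦ hv (hdiv v h)
  exact selmerLocalKer_le_unramifiedKer (hlg v) hred hv' hn' h𝔓
    (((mem_selmerGroup_iff W n c).mp hc).1 v)

end WeierstrassCurve
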